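import Summits.QuantumFields.YangMills.Theorems.BalabanUVNodesN11TransportFineGaugeOrbitAverage
import Summits.QuantumFields.YangMills.Theorems.BalabanUVNodesN11TopPairNewAction
import Summits.QuantumFields.YangMills.Theorems.BalabanUVNodesN13DensityOfRecordIsAveragedGibbsMeasureAtRecord13SepCoPH

/-!
# DAG node N11 — THE OLD SIDE OF THE TOP PAIR's MAIN TERM READS (3.3)'s `χ′_0·Σ_S ζ_1` ONLY THROUGH ITS FINE-GAUGE ORBIT AVERAGE; `χ′_k` IS MOVED BY THE FINE GAUGE GROUP;
# the orbit average is itself fine-gauge invariant (so the block-comb gauge applies to it)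

HEADER — WORK-UNIT METADATA.  Cell `pub-ymgap`, YM-PLAN Track A (HUMAN RULING D-0062), R134 fan-out seat `pub-ymgap-dag-n11-e` (g31) on node N11 [B14]; route
`BalabanUVNodes`, key K1⁹ = stmt-QuantumFields-27364 (helper, `--kind proof --supports 27364 --as helper`, count-neutral).  [I] = [Balaban1987RG1], [III] = [Balaban1988Convergent].
Sibling of this seat's g31 `…N11TransportFineGaugeOrbitAverage` (the ORBIT-AVERAGE LAW of def-T's (†), generic ∕ `texpASucc` ∕ record editions) — BY NAME; over dag-n11-d g18's
`…N11TopPairNewAction` (`firstStep_O3_top_iff_explicit`: the main term of N11's first 𝐓-law with both sides open; its letters only), r11's `B14Sect3Decomp` (`chiPrime`,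
`SmallApproxFluct`, `Vbox`), `B12FaddeevPopov016` (`fineTransf`), gen 15's `T4AxialGaugeFixing` (`siteTransf`), dag-n13's `integrable_rhoZeroOfRecord`.

WHY.  dag-n11-d's top-pair identity (k = 0, `(Ω₁,Λ₁) = (𝕋,𝕋)`; [I] Thm 1 + [II] at the tree's objects) has OLD side
`∫dU δ(ŪV′⁻¹)[χ′_0(ALL)(U,V′)·Σ_S ζ_1(∅,∅,(∅,S))(U,V′)·ρ₀(U)](V′)` — def-T's (†) with def-T's step weight at the label `(P,Q,R) = (∅,∅,∅)`.  `dU`, `Ū`, `ρ₀ = e^{−E}e^{−A∕g₀²}` are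
invariant under the fine gauge group `u(emb y) = 1`; the weight is not (§2: (3.3)'s `χ′` compares `U(b)` bondwise with the background `U_{1,□}(V′)(b)`, which does not co-move).
By the sibling's law the old side therefore equals, for a.e. `V′`, the transport of the weight AVERAGED UNIFORMLY over the fine gauge orbit (§3) — and the (O3′) clause there
constrains only that average, whatever new side `𝒩(V′)` and support condition are displayed.  Print reads (3.3) under (1.6) ([III] p.265 L.8–12: «we introduce the axial gauge
fixing as in (1.5), with V_k, ε_k, g_k … We get an expansion of the form (1.6) … Next … (3.3)»), i.e. against [I] (0.19)'s Faddeev–Popov factor `χ_Ax·e^{−G(U)∕g₀²}∕zⁿ`, which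
concentrates the orbit integral at the block axial gauge; the integrand of (†) carries no such factor (def-T `TStepOfRecord.tstepIntegrand`; `|w| ≤ 1`, `IsStepUnity` pointwise).
Recorded as a READING for the type owner (node00-def-T) and the K-lanes, not as a defect claim on any landed theorem: where (1.5)'s factor enters (†) is theirs to decide.

WHAT THIS FILE PROVES (0 `def`, 0 `sorry`, standard axioms).
§1 (generic `RegularGaugeGroup` with Haar data): `fineTransf_mul_apply_of_fineGauge` · `gaugeAct_fineTransf_gaugeAct_of_fineGauge` (`(U^u)^{u_g} = U^{u_{g·u|}}`, fine `u`) ·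
   ★ `fineGaugeInvariant_fineOrbitAvg` (`f^{av}(U^u) = f^{av}(U)`: right invariance of the product Haar measure of the fine gauge group) — so the sibling's §4 presents (†) as the
   transport of the INVARIANT density `f^{av}·ρ`, to which this seat's g28 block-comb gauge `…N11TransportBlockCombGauge` applies.
§2 (generic `GaugeGroup`, r11's `Sect3Data`): ★★ `chiPrime_not_fineGaugeInvariant` — for ANY (3.3)∕(3.4) data, `2δ > 0`, a cube whose bond set holds a bond `b` with `b.src` not a
   centre and `b.tgt ≠ b.src`, and `g ∈ G` with `2δ ≤ |g − 1|`: `V_k ↦ χ′_k(□′)(V_k, V_{k+1})` is NOT fine-gauge invariant (witness: the background itself and the one-site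
   transformation `g` at `b.src`).  Consequence: this seat's g22 `Node00/TStepOfRecordGaugeFixing` (FP factor immaterial under (†) GIVEN `hwinv` «every `w(s′)(·,V′)` fine-gauge
   invariant») does not apply to a weight carrying `χ′_k`; the sibling's law does.
§3 Stage-13 record, top pair (`0 < K`, any `θ`, `p`, length-1 `s′`; displayed provisos: the weight `χ′_0(ALL)·Σ_Sζ_1(∅,∅,(∅,S))` jointly measurable and bounded — def-T's
   (O4) ∕ `abs_wOfRecord_le_one` rows): ★★★ `firstStep_oldSide_ae_eq_fineOrbitAvg` (old side `=ᵐ` transport of `[χ′_0·Σ_Sζ_1]^{av}·ρ₀`) · ★★★ `firstStep_oldSide_clause_iff_fineOrbitAvg`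
   (for ANY `𝒩`, `χ`: «`χ(V′) ≠ 0 → old side(V′) = 𝒩(V′)` a.e.» ⟺ the same with the orbit-averaged weight).

HONEST FRAMING.  Helper lane of K1⁹, count-neutral; [folklore] measure theory + one explicit non-invariance witness, composed BY NAME; nothing of Bałaban's ESTIMATES asserted;
no identity of print asserted or refuted; (O3′) ∕ Thm 1 ∕ Thm 2 NOT touched; N11 NOT discharged; K1⁹ NOT closed; counts unmoved (typed 28∕28 · discharged 5∕27).  One finite
four-torus programme at fixed `ε = L^{−K}` — NOT ℝ⁴, NOT OS, NOT a mass gap, NOT Clay.  No `sorry`, `axiom`, `def`, `instance`, `notation`.  Sources (SHAPE ∕ bookkeeping only):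
[III] (1.5)–(1.6) p.247, (3.1) p.264, (3.3)–(3.4) p.265 with L.8–12, (3.25) p.270, Thm 1 p.262; [I] (0.13)–(0.16) pp.254–255, (0.19) p.255, Thm 1 p.259; [Balaban1985Averaging] (8)–(12) p.19.
-/

noncomputable section

open MeasureTheory Function
open scoped ENNReal BigOperators

namespace Summit.QuantumFields.YangMills.Theorems.BalabanUVNodesN11TopPairOldSideFineGaugeOrbitAverage

open Literature.MathematicalPhysics.QuantumFieldTheory.Balaban1983to89
open GaugeField (gaugeAct)
open B12FaddeevPopov016 (FineGauge FineGaugeInvariant FPIdx fineTransf fineTransf_emb)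
open T4AxialGaugeFixing (siteTransf siteTransf_self siteTransf_of_ne)
open BalabanUVNodesN11TransportFineGaugeOrbitAverage
open Summit.QuantumFields.YangMills.BalabanUVNodes.N13DensityOfRecordIsAveragedGibbsMeasureAtRecord13SepCoPH (integrable_rhoZeroOfRecord)

/-! ## §1  The fine-gauge orbit average IS fine-gauge invariant (so the block-comb gauge of `…N11TransportBlockCombGauge` applies to `f^{av}·ρ`) -/

section Invariance

variable {P : Params} {j : ℕ} {G : Type*} [GaugeGroup G] [MeasurableSpace G] [HaarData G] [RegularGaugeGroup G]

omit [MeasurableSpace G] [HaarData G] [RegularGaugeGroup G] in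
/-- Composition inside the fine gauge group: for a fine `u` (`u(emb y) = 1`), `fineTransf g · u = fineTransf (g · u|)` sitewise, `(g · u|)(y,x) = g(y,x)·u(x)`.
[cite: Balaban1987RG1, (0.13) p.254 (bookkeeping)] -/
theorem fineTransf_mul_apply_of_fineGauge (g : FPIdx P j → G) {u : GaugeTransf P j G} (hu : FineGauge u) (x : Site P j) :
    fineTransf g x * u x = fineTransf (fun i : FPIdx P j => g i * u (i.2 : Site P j)) x := by
  by_cases h : x ∈ (block (blockOf x)).erase (emb (blockOf x))
  · simp only [fineTransf, dif_pos h]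
  · -- `x` is the centre of its block: both sides are `1`
    have hx : x = emb (blockOf x) := by
      by_contra hne
      exact h (Finset.mem_erase.2 ⟨hne, by simp [block]⟩)
    simp only [fineTransf, dif_neg h, one_mul]
    rw [hx]; exact hu _

omit [MeasurableSpace G] [HaarData G] [RegularGaugeGroup G] in
/-- `(U^{u})^{u_g} = U^{u_{g·u|}}` for a fine `u`. [cite: Balaban1985Averaging, (8) p.18 (bookkeeping)] -/
theorem gaugeAct_fineTransf_gaugeAct_of_fineGauge (g : FPIdx P j → G) {u : GaugeTransf P j G} (hu : FineGauge u)
    (U : GaugeField P j G) :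
    gaugeAct (fineTransf g) (gaugeAct u U) = gaugeAct (fineTransf (fun i : FPIdx P j => g i * u (i.2 : Site P j))) U := by
  funext b
  simp only [gaugeAct, ← fineTransf_mul_apply_of_fineGauge g hu, mul_inv_rev, mul_assoc]

/-- ★ **THE FINE-GAUGE ORBIT AVERAGE IS FINE-GAUGE INVARIANT**: `f^{av}(U^u) = f^{av}(U)` for every fine `u` and every `f` (right invariance of the product Haar measure of
the fine gauge group).  Hence §4 of `…N11TransportFineGaugeOrbitAverage` presents (†) as the transport of the INVARIANT density `f^{av}·ρ`, to which this seat's block-comb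
gauge (`…N11TransportBlockCombGauge`) applies. [cite: Balaban1985Averaging, (10)–(12) p.19; Balaban1987RG1, (0.13)–(0.16) pp.254–255] -/
theorem fineGaugeInvariant_fineOrbitAvg (f : GaugeField P j G → ℝ) :
    FineGaugeInvariant (fun U : GaugeField P j G =>
      ∫ g, f (gaugeAct (fineTransf g) U) ∂Measure.pi (fun _ : FPIdx P j => (HaarData.haar : Measure G))) := by
  intro u hu U
  haveI : IsProbabilityMeasure (HaarData.haar : Measure G) := HaarData.isProb
  haveI : (HaarData.haar : Measure G).IsMulRightInvariant := ⟨HaarData.map_mul_right⟩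
  show (∫ g, f (gaugeAct (fineTransf g) (gaugeAct u U)) ∂Measure.pi (fun _ : FPIdx P j => (HaarData.haar : Measure G))) = _
  simp_rw [gaugeAct_fineTransf_gaugeAct_of_fineGauge _ hu U]
  exact integral_mul_right_eq_self (μ := Measure.pi (fun _ : FPIdx P j => (HaarData.haar : Measure G)))
    (fun g : FPIdx P j → G => f (gaugeAct (fineTransf g) U)) (fun i : FPIdx P j => u (i.2 : Site P j))

end Invariance

/-! ## §2  (3.3)'s approximate-fluctuation indicator `χ′_k` IS MOVED by the fine gauge group (so `…TStepOfRecordGaugeFixing`'s displayed `hwinv` is not met by a weight carrying it) -/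

section ChiPrime

open B14.Sect3Decomp

variable {P : Params} {G : Type*} [GaugeGroup G] {k : ℕ}

/-- ★★ **`χ′_k` OF (3.3) IS NOT FINE-GAUGE INVARIANT.**  For r11's (3.3)∕(3.4) data `D` (any averaging `av`, any background map), a threshold `2δ > 0`, a cube `□′` whose bond
set `(□′^{∼2})^{(k)*}` contains a bond `b` with `b.src` not a block centre and `b.tgt ≠ b.src`, and a group element `g` with `2δ ≤ |g − 1|`: the one-site gauge transformation
`u = (g at b.src, 1 elsewhere)` is fine and turns the background itself (`χ′_k(□′) = 1`) into a configuration with `χ′_k(□′) = 0`.  (3.3) compares `V_k(b)` bondwise with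
`V^{(k)}_{□′}(V_{k+1})(b)`, which does not co-move: print reads it inside the Faddeev–Popov gauge-fixed integral (1.6) ([III] p.265 L.8–12), where `V_k` is near the block axial gauge.
[cite: Balaban1988Convergent, (3.3)–(3.4) p.265, (1.5)–(1.6) p.247] -/
theorem chiPrime_not_fineGaugeInvariant (D : Sect3Data P G k) (av : ∀ j, Averaging P j G) {twoδ : ℝ} (h0 : 0 < twoδ) (c : D.Cube1)
    {b : PBond P k} (hb : b ∈ D.bondsStar c) (hsrc : ∀ y : Site P (k + 1), b.src ≠ emb y) (htgt : b.tgt ≠ b.src)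
    {g : G} (hg : twoδ ≤ dist1 g) (V : GaugeField P (k + 1) G) :
    ¬ FineGaugeInvariant (fun Vk : GaugeField P k G => chiPrime D av twoδ {c} Vk V) := by
  classical
  intro hinv
  have hu : FineGauge (siteTransf b.src g) := Node00.fineGauge_siteTransf_of_forall_ne_emb hsrc g
  have key : chiPrime D av twoδ {c} (gaugeAct (siteTransf b.src g) (Vbox D av c V)) V = chiPrime D av twoδ {c} (Vbox D av c V) V :=
    hinv (siteTransf b.src g) hu (Vbox D av c V)
  -- the background itself satisfies (3.3): every ratio is `1`
  have h1 : chiPrime D av twoδ {c} (Vbox D av c V) V = 1 := by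
    rw [chiPrime_eq_one_iff]
    intro c' hc' b' _
    rw [Finset.mem_singleton] at hc'
    subst hc'
    rw [mul_inv_cancel, GaugeGroup.dist1_one]
    exact h0
  -- after the one-site transformation the ratio at `b` is `g`
  have hbad : ¬ SmallApproxFluct D av twoδ (gaugeAct (siteTransf b.src g) (Vbox D av c V)) V c := by
    intro hs
    have hlt := hs b hb
    have e : gaugeAct (siteTransf b.src g) (Vbox D av c V) b * (Vbox D av c V b)⁻¹ = g := by
      simp only [gaugeAct, siteTransf_self, siteTransf_of_ne htgt, inv_one, mul_one, mul_inv_cancel_right]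
    rw [e] at hlt
    exact absurd hlt (not_lt.2 hg)
  have h2 : chiPrime D av twoδ {c} (gaugeAct (siteTransf b.src g) (Vbox D av c V)) V = 0 := by
    unfold chiPrime
    rw [Finset.prod_singleton, if_neg hbad]
  rw [h1, h2] at key
  exact zero_ne_one key

end ChiPrime

/-! ## §3  THE TOP PAIR `(Ω₁, Λ₁) = (𝕋, 𝕋)` OF THE STAGE-13 RECORD: the old side of dag-n11-d's `firstStep_O3_top_iff_explicit` -/

section TopPair

open T4Continuum Node00 B14.Sect3Decomp

variable {F : T4Family} {N : ℕ} [NeZero N]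

/-- ★★★ **THE OLD SIDE OF THE MAIN TERM OF N11's FIRST 𝐓-LAW READS (3.3)'s `χ′_0·Σ_S ζ_1` ONLY THROUGH ITS FINE-GAUGE ORBIT AVERAGE.**  At the Stage-13 record, a run `p` with
`0 < K`, a length-1 history `s′`: the old side of `…N11TopPairNewAction.firstStep_O3_top_iff_explicit`,
`V′ ↦ ∫dU δ(ŪV′⁻¹) [χ′_0(ALL)(U,V′) · Σ_S ζ_1(∅,∅,(∅,S))(U,V′) · ρ₀(U)] (V′)`, equals for `dV′`-a.e. `V′` the transport of
`[∫∏dg (χ′_0(ALL)·Σ_S ζ_1(∅,∅,(∅,S)))(U^{u_g},V′)] · ρ₀(U)` — the weight averaged uniformly over the fine gauge group `u(emb y) = 1` of `T^{(0)}` — under the displayed provisos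
that the weight `χ′_0·Σ_Sζ_1` is jointly measurable and bounded (def-T displays the measurability of its step weights, `StepWeightsOfRecord` (O4); `|w| ≤ 1` is its
`abs_wOfRecord_le_one`).  (3.3)'s `χ′_0` compares `U(b)` bondwise with the background `U_{1,□}(V′)` and is NOT fine-gauge invariant; print reads it under (1.6), i.e. against
the Faddeev–Popov weight of (1.5) ([III] p.265 L.8–12), which the integrand of (†) does not carry.
[cite: Balaban1988Convergent, (3.1) p.264, (3.3) p.265, (1.5)–(1.6) p.247, Thm 1 p.262; Balaban1987RG1, (0.13)–(0.16) pp.254–255, Thm 1 p.259] -/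
theorem firstStep_oldSide_ae_eq_fineOrbitAvg (θ : Stage13HParams F N) (p : B12.RunParams) (hK : 0 < p.K)
    (s' : SeqOfRecord F θ.ν θ.τ9.M (gOfRecord₁₃ F N θ.toStage13Params p) p.K 1)
    (hm : Measurable fun q : GaugeField (F.P p.K) 0 (SU N) × GaugeField (F.P p.K) 1 (SU N) =>
      chiPrime (sect3DataOfRecord F N θ.ν θ.τ9.M p (gOfRecord₁₃ F N θ.toStage13Params p) 0 s'.init) (avOfRecord F N p.K)
          (2 * deltaOfRecord θ.ν (gOfRecord₁₃ F N θ.toStage13Params p) 0 θ.A₁) (Finset.univ : Finset (Iχ F θ.ν p (gOfRecord₁₃ F N θ.toStage13Params p) 0)) q.1 q.2 *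
        ∑ S : Finset (Iχ F θ.ν p (gOfRecord₁₃ F N θ.toStage13Params p) 0), θ.ζ p (gOfRecord₁₃ F N θ.toStage13Params p) 0 s'.init ∅ ∅ (∅, S) q.1 q.2)
    {C : ℝ} (hb : ∀ U V',
      |chiPrime (sect3DataOfRecord F N θ.ν θ.τ9.M p (gOfRecord₁₃ F N θ.toStage13Params p) 0 s'.init) (avOfRecord F N p.K)
          (2 * deltaOfRecord θ.ν (gOfRecord₁₃ F N θ.toStage13Params p) 0 θ.A₁) (Finset.univ : Finset (Iχ F θ.ν p (gOfRecord₁₃ F N θ.toStage13Params p) 0)) U V' *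
        ∑ S : Finset (Iχ F θ.ν p (gOfRecord₁₃ F N θ.toStage13Params p) 0), θ.ζ p (gOfRecord₁₃ F N θ.toStage13Params p) 0 s'.init ∅ ∅ (∅, S) U V'| ≤ C) :
    (fun V' => transportOfRecord F N p.K 0 (fun U =>
        chiPrime (sect3DataOfRecord F N θ.ν θ.τ9.M p (gOfRecord₁₃ F N θ.toStage13Params p) 0 s'.init) (avOfRecord F N p.K)
            (2 * deltaOfRecord θ.ν (gOfRecord₁₃ F N θ.toStage13Params p) 0 θ.A₁) (Finset.univ : Finset (Iχ F θ.ν p (gOfRecord₁₃ F N θ.toStage13Params p) 0)) U V' *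
          (∑ S : Finset (Iχ F θ.ν p (gOfRecord₁₃ F N θ.toStage13Params p) 0), θ.ζ p (gOfRecord₁₃ F N θ.toStage13Params p) 0 s'.init ∅ ∅ (∅, S) U V') *
          rhoZeroOfRecord F N p.K (gOfRecord₁₃ F N θ.toStage13Params p 0) (EOfRecord₁₃ F N θ.toStage13Params p) U) V')
      =ᵐ[fieldMeasure (F.P p.K) 1 (SU N)]
    fun V' => transportOfRecord F N p.K 0 (fun U =>
        (∫ g, chiPrime (sect3DataOfRecord F N θ.ν θ.τ9.M p (gOfRecord₁₃ F N θ.toStage13Params p) 0 s'.init) (avOfRecord F N p.K)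
              (2 * deltaOfRecord θ.ν (gOfRecord₁₃ F N θ.toStage13Params p) 0 θ.A₁) (Finset.univ : Finset (Iχ F θ.ν p (gOfRecord₁₃ F N θ.toStage13Params p) 0))
              (gaugeAct (fineTransf g) U) V' *
            ∑ S : Finset (Iχ F θ.ν p (gOfRecord₁₃ F N θ.toStage13Params p) 0),
              θ.ζ p (gOfRecord₁₃ F N θ.toStage13Params p) 0 s'.init ∅ ∅ (∅, S) (gaugeAct (fineTransf g) U) V'
          ∂Measure.pi (fun _ : FPIdx (F.P p.K) 0 => (HaarData.haar : Measure (SU N)))) *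
          rhoZeroOfRecord F N p.K (gOfRecord₁₃ F N θ.toStage13Params p 0) (EOfRecord₁₃ F N θ.toStage13Params p) U) V' :=
  transportOfRecord_family_mul_ae_eq_fineOrbitAvg F N hK (fineGaugeInvariant_rhoZeroOfRecord F N p.K _ _) (integrable_rhoZeroOfRecord F N p.K _ _) hm hb

/-- ★★★ **HENCE THE (O3′) CLAUSE AT THE TOP PAIR CONSTRAINS ONLY THE ORBIT-AVERAGED WEIGHT**: for ANY new side `𝒩(V′)` and ANY support condition `χ(V′) ≠ 0` (dag-n11-d's:
`𝒩` = `ζ_0(∅)w_0(base₁V′)·e^{−e₁}·exp(Σ[Re 𝐄^{(1)}(U_1(V′)) − Re 𝐄^{(1)}(1)] + Σ[Re 𝐑^{(1)}(U_1(V′)) − Re 𝐑^{(1)}(1)])·e^{−A(U_1(V′))∕g₀²}`, `χ` = `χ₁(s′)`), the a.e. identity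
«`χ(V′) ≠ 0 → ∫dU δ(ŪV′⁻¹)[χ′_0·Σ_Sζ_1·ρ₀](V′) = 𝒩(V′)`» holds IFF it holds with `χ′_0·Σ_Sζ_1` replaced by its fine-gauge orbit average.
[cite: Balaban1988Convergent, (3.1) p.264, (3.3) p.265, (3.25) p.270, Thm 1 p.262; Balaban1987RG1, Thm 1 p.259, (0.22)–(0.25) pp.256–257] -/
theorem firstStep_oldSide_clause_iff_fineOrbitAvg (θ : Stage13HParams F N) (p : B12.RunParams) (hK : 0 < p.K)
    (s' : SeqOfRecord F θ.ν θ.τ9.M (gOfRecord₁₃ F N θ.toStage13Params p) p.K 1)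
    (hm : Measurable fun q : GaugeField (F.P p.K) 0 (SU N) × GaugeField (F.P p.K) 1 (SU N) =>
      chiPrime (sect3DataOfRecord F N θ.ν θ.τ9.M p (gOfRecord₁₃ F N θ.toStage13Params p) 0 s'.init) (avOfRecord F N p.K)
          (2 * deltaOfRecord θ.ν (gOfRecord₁₃ F N θ.toStage13Params p) 0 θ.A₁) (Finset.univ : Finset (Iχ F θ.ν p (gOfRecord₁₃ F N θ.toStage13Params p) 0)) q.1 q.2 *
        ∑ S : Finset (Iχ F θ.ν p (gOfRecord₁₃ F N θ.toStage13Params p) 0), θ.ζ p (gOfRecord₁₃ F N θ.toStage13Params p) 0 s'.init ∅ ∅ (∅, S) q.1 q.2)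
    {C : ℝ} (hb : ∀ U V',
      |chiPrime (sect3DataOfRecord F N θ.ν θ.τ9.M p (gOfRecord₁₃ F N θ.toStage13Params p) 0 s'.init) (avOfRecord F N p.K)
          (2 * deltaOfRecord θ.ν (gOfRecord₁₃ F N θ.toStage13Params p) 0 θ.A₁) (Finset.univ : Finset (Iχ F θ.ν p (gOfRecord₁₃ F N θ.toStage13Params p) 0)) U V' *
        ∑ S : Finset (Iχ F θ.ν p (gOfRecord₁₃ F N θ.toStage13Params p) 0), θ.ζ p (gOfRecord₁₃ F N θ.toStage13Params p) 0 s'.init ∅ ∅ (∅, S) U V'| ≤ C)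
    (χ 𝒩 : GaugeField (F.P p.K) 1 (SU N) → ℝ) :
    (∀ᵐ V' ∂fieldMeasure (F.P p.K) 1 (SU N), χ V' ≠ 0 →
      transportOfRecord F N p.K 0 (fun U =>
        chiPrime (sect3DataOfRecord F N θ.ν θ.τ9.M p (gOfRecord₁₃ F N θ.toStage13Params p) 0 s'.init) (avOfRecord F N p.K)
            (2 * deltaOfRecord θ.ν (gOfRecord₁₃ F N θ.toStage13Params p) 0 θ.A₁) (Finset.univ : Finset (Iχ F θ.ν p (gOfRecord₁₃ F N θ.toStage13Params p) 0)) U V' *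
          (∑ S : Finset (Iχ F θ.ν p (gOfRecord₁₃ F N θ.toStage13Params p) 0), θ.ζ p (gOfRecord₁₃ F N θ.toStage13Params p) 0 s'.init ∅ ∅ (∅, S) U V') *
          rhoZeroOfRecord F N p.K (gOfRecord₁₃ F N θ.toStage13Params p 0) (EOfRecord₁₃ F N θ.toStage13Params p) U) V' = 𝒩 V') ↔
    ∀ᵐ V' ∂fieldMeasure (F.P p.K) 1 (SU N), χ V' ≠ 0 →
      transportOfRecord F N p.K 0 (fun U =>
        (∫ g, chiPrime (sect3DataOfRecord F N θ.ν θ.τ9.M p (gOfRecord₁₃ F N θ.toStage13Params p) 0 s'.init) (avOfRecord F N p.K)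
              (2 * deltaOfRecord θ.ν (gOfRecord₁₃ F N θ.toStage13Params p) 0 θ.A₁) (Finset.univ : Finset (Iχ F θ.ν p (gOfRecord₁₃ F N θ.toStage13Params p) 0))
              (gaugeAct (fineTransf g) U) V' *
            ∑ S : Finset (Iχ F θ.ν p (gOfRecord₁₃ F N θ.toStage13Params p) 0),
              θ.ζ p (gOfRecord₁₃ F N θ.toStage13Params p) 0 s'.init ∅ ∅ (∅, S) (gaugeAct (fineTransf g) U) V'
          ∂Measure.pi (fun _ : FPIdx (F.P p.K) 0 => (HaarData.haar : Measure (SU N)))) *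
          rhoZeroOfRecord F N p.K (gOfRecord₁₃ F N θ.toStage13Params p 0) (EOfRecord₁₃ F N θ.toStage13Params p) U) V' = 𝒩 V' :=
  ae_imp_transportOfRecord_family_eq_iff_fineOrbitAvg F N hK (fineGaugeInvariant_rhoZeroOfRecord F N p.K _ _) (integrable_rhoZeroOfRecord F N p.K _ _)
    hm hb χ 𝒩

end TopPair

end Summit.QuantumFields.YangMills.Theorems.BalabanUVNodesN11TopPairOldSideFineGaugeOrbitAverage

end
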